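import Literature.Probability.LatticeModels.PercolationRowTransferProduct
import Literature.Probability.LatticeModels.PercolationPolygonWord

/-!
# Junction calculus for the row-transfer representation of bond percolation

Bookkeeping identities for the junction letters `J_{S,S'}` (`junctionInsert`, new columns as
singletons) and `J_{S',S}` (`junctionRestrict`, forget columns) of
`Literature.Probability.LatticeModels.PercolationRowTransfer`, needed whenever amplitudes of
polygon words `⟨α| T … J … T |β⟩` are expanded over eigenvectors of the transfer matrices
(route `CriticalPhenomena/CardyPolygonWords`, items `JunctionOverlapLimit`, `WordSewing`):

* `sum_statePushforward_mul` — push-forward / pull-back duality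
  `⟨f_* μ, g⟩ = ⟨μ, g ∘ f⟩` for distributions `μ` and observables `g` on finite state spaces;
* `junctionRestrict_comp_junctionInsert` — `J_{S',S} ∘ J_{S,S'} = id` (insertion is a section of
  restriction, from `restrictState_insertState`), and its pointwise form;
* `joinedToStar_insertState_iff`, `rowReadout_insertState` — inserting free columns does not
  change which sites are joined to the bottom arc, so the read-out functional `β` is preserved:
  `β_{S'} ∘ insertState = β_S`, whence `⟨J_{S,S'} μ, β_{S'}⟩ = ⟨μ, β_S⟩`
  (`sum_junctionInsert_mul_rowReadout`);
* the same for the two-star states of `PercolationPolygonWord` (the version polygon words use):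
  `junctionRestrict₂_comp_junctionInsert₂`, `rowReadout₂_insertState₂`,
  `rowReadout₂_restrictState₂` (both junction directions preserve the read-out "⋆_A ~ ⋆_B"),
  `sum_junctionInsert₂_mul_rowReadout₂`, `sum_junctionRestrict₂_mul_rowReadout₂`.

Sources: Bondesan–Jacobsen–Saleur, arXiv:1207.7005, §2, §5 (junctions between strips of different
widths) (`BondesanJacobsenSaleur2012`); Cardy, arXiv:math-ph/0103018, §7.1 (`Cardy2001`). All
statements are elementary finite bookkeeping ([folklore]). Not here: anything spectral.
-/

noncomputable section

open Finset Matrix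
open scoped BigOperators Classical

namespace Literature.Probability.LatticeModels

/-! ### Push-forward / pull-back duality -/

section Pushforward

variable {ι κ : Type*} [Fintype ι] [Fintype κ]

/-- **Duality of push-forward and pull-back.** Pairing the push-forward `f_* μ` of a distribution
`μ` with an observable `g` equals pairing `μ` with the pulled-back observable `g ∘ f`:
`∑_k (f_* μ)(k) g(k) = ∑_i μ(i) g(f i)`. [folklore] -/
theorem sum_statePushforward_mul (f : ι → κ) (μ : ι → ℝ) (g : κ → ℝ) :
    ∑ k, statePushforward f μ k * g k = ∑ i, μ i * g (f i) := by
  simp only [statePushforward_apply, Finset.sum_mul]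
  rw [(Finset.sum_fiberwise_of_maps_to (s := univ) (t := univ) (g := f)
    (fun i _ => mem_univ (f i)) (f := fun i => μ i * g (f i))).symm]
  refine Finset.sum_congr rfl fun k _ => Finset.sum_congr rfl fun i hi => ?_
  rw [(Finset.mem_filter.mp hi).2]

/-- Push-forward along a map with a left inverse, followed by push-forward along that left
inverse, is the identity. [folklore] -/
theorem statePushforward_comp_of_leftInverse {f : ι → κ} {g : κ → ι}
    (h : Function.LeftInverse g f) :
    statePushforward g ∘ₗ statePushforward f = LinearMap.id := by
  rw [← statePushforward_comp, h.comp_eq_id]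
  exact statePushforward_id'

end Pushforward

/-! ### `J_{S',S} ∘ J_{S,S'} = id` -/

section Junction

variable {S S' : Finset ℤ}

/-- **Insertion is a section of restriction, on distributions**: `J_{S',S} ∘ J_{S,S'} = id`
(`S ⊆ S'`). [cite: BondesanJacobsenSaleur2012, §2] -/
theorem junctionRestrict_comp_junctionInsert (h : S ⊆ S') :
    junctionRestrict h ∘ₗ junctionInsert h = LinearMap.id :=
  statePushforward_comp_of_leftInverse (restrictState_insertState h)

/-- Pointwise form of `junctionRestrict_comp_junctionInsert`. [cite: BondesanJacobsenSaleur2012, §2] -/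
theorem junctionRestrict_junctionInsert (h : S ⊆ S') (μ : RowState S → ℝ) :
    junctionRestrict h (junctionInsert h μ) = μ := by
  have := LinearMap.congr_fun (junctionRestrict_comp_junctionInsert h) μ
  simpa using this

/-- `J_{S,S'}` preserves the total mass of a distribution. [folklore] -/
theorem sum_junctionInsert (h : S ⊆ S') (μ : RowState S → ℝ) :
    ∑ π', junctionInsert h μ π' = ∑ π, μ π :=
  sum_statePushforward _ μ

/-- `J_{S',S}` preserves the total mass of a distribution. [folklore] -/
theorem sum_junctionRestrict (h : S ⊆ S') (μ' : RowState S' → ℝ) :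
    ∑ π, junctionRestrict h μ' π = ∑ π', μ' π' :=
  sum_statePushforward _ μ'

/-! ### Insertion does not change who is joined to the bottom arc -/

/-- In an inserted pattern, a site of `S'` is joined to `⋆` iff it is an old site (a column of
`S`) that was joined to `⋆`; the freshly inserted columns are singletons.
[cite: BondesanJacobsenSaleur2012, §2] -/
theorem joinedToStar_insertState_iff (h : S ⊆ S') (π : RowState S) (x : S') :
    (insertState h π).JoinedToStar x ↔ ∃ hx : (x : ℤ) ∈ S, π.JoinedToStar ⟨x, hx⟩ := by
  change (insertRel h π.rel) (Sum.inl x) (RowPoint.star S') ↔ _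
  constructor
  · rintro (hx | ⟨a', b', ha, hb, hab⟩)
    · exact absurd hx (by simp [RowPoint.star])
    · rcases a' with a' | u
      · rcases b' with b' | v
        · exact absurd hb (by simp [RowPoint.incl, RowPoint.star])
        · simp only [RowPoint.incl, Sum.inl.injEq] at ha
          subst ha
          exact ⟨a'.2, by simpa [RowState.JoinedToStar, RowPoint.star] using hab⟩
      · exact absurd ha (by simp [RowPoint.incl])
  · rintro ⟨hx, hπ⟩
    refine Or.inr ⟨Sum.inl ⟨x, hx⟩, RowPoint.star S, ?_, rfl, hπ⟩
    simp [RowPoint.incl]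

/-- **The read-out functional is preserved by insertion**: `β_{S'} (insertState π) = β_S π`.
[cite: Cardy2001, §7.1] -/
theorem rowReadout_insertState (h : S ⊆ S') (π : RowState S) :
    rowReadout S' (insertState h π) = rowReadout S π := by
  unfold rowReadout
  have : (∃ x : S', (insertState h π).JoinedToStar x) ↔ ∃ x : S, π.JoinedToStar x := by
    constructor
    · rintro ⟨x, hx⟩
      obtain ⟨hxS, hπ⟩ := (joinedToStar_insertState_iff h π x).mp hx
      exact ⟨⟨x, hxS⟩, hπ⟩
    · rintro ⟨x, hx⟩
      exact ⟨⟨x, h x.2⟩, (joinedToStar_insertState_iff h π ⟨x, h x.2⟩).mpr ⟨x.2, hx⟩⟩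
  simp only [this]

/-- **`⟨J_{S,S'} μ, β_{S'}⟩ = ⟨μ, β_S⟩`**: the crossing amplitude read out right after a
free-column insertion equals the amplitude read out before it. [cite: Cardy2001, §7.1] -/
theorem sum_junctionInsert_mul_rowReadout (h : S ⊆ S') (μ : RowState S → ℝ) :
    ∑ π', junctionInsert h μ π' * rowReadout S' π' = ∑ π, μ π * rowReadout S π := by
  unfold junctionInsert
  rw [sum_statePushforward_mul]
  simp_rw [rowReadout_insertState]

end Junction

/-! ### Two-star states -/

section TwoStar

variable {S S' : Finset ℤ}

/-- **`J_{S',S} ∘ J_{S,S'} = id` on distributions of two-star states** (`S ⊆ S'`).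
[cite: BondesanJacobsenSaleur2012, §5] -/
theorem junctionRestrict₂_comp_junctionInsert₂ (h : S ⊆ S') :
    junctionRestrict₂ h ∘ₗ junctionInsert₂ h = LinearMap.id :=
  statePushforward_comp_of_leftInverse (restrictState₂_insertState₂ h)

/-- Pointwise form of `junctionRestrict₂_comp_junctionInsert₂`. [cite: BondesanJacobsenSaleur2012, §5] -/
theorem junctionRestrict₂_junctionInsert₂ (h : S ⊆ S') (μ : RowState₂ S → ℝ) :
    junctionRestrict₂ h (junctionInsert₂ h μ) = μ := by
  have := LinearMap.congr_fun (junctionRestrict₂_comp_junctionInsert₂ h) μ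
  simpa using this

/-- **Insertion preserves the two-star read-out**: `β_{S'} (insertState₂ π) = β_S π`.
[cite: Cardy2001, §7.1] -/
theorem rowReadout₂_insertState₂ (h : S ⊆ S') (π : RowState₂ S) :
    rowReadout₂ S' (insertState₂ h π) = rowReadout₂ S π := by
  unfold rowReadout₂
  simp only [starsJoined_insertState₂]

/-- **Restriction preserves the two-star read-out**: `β_S (restrictState₂ π') = β_{S'} π'`.
[cite: Cardy2001, §7.1] -/
theorem rowReadout₂_restrictState₂ (h : S ⊆ S') (π' : RowState₂ S') :
    rowReadout₂ S (restrictState₂ h π') = rowReadout₂ S' π' := by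
  unfold rowReadout₂
  simp only [starsJoined_restrictState₂]

/-- **`⟨J_{S,S'} μ, β_{S'}⟩ = ⟨μ, β_S⟩`** for two-star states. [cite: Cardy2001, §7.1] -/
theorem sum_junctionInsert₂_mul_rowReadout₂ (h : S ⊆ S') (μ : RowState₂ S → ℝ) :
    ∑ π', junctionInsert₂ h μ π' * rowReadout₂ S' π' = ∑ π, μ π * rowReadout₂ S π := by
  unfold junctionInsert₂
  rw [sum_statePushforward_mul]
  simp_rw [rowReadout₂_insertState₂]

/-- **`⟨J_{S',S} μ', β_S⟩ = ⟨μ', β_{S'}⟩`** for two-star states. [cite: Cardy2001, §7.1] -/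
theorem sum_junctionRestrict₂_mul_rowReadout₂ (h : S ⊆ S') (μ' : RowState₂ S' → ℝ) :
    ∑ π, junctionRestrict₂ h μ' π * rowReadout₂ S π = ∑ π', μ' π' * rowReadout₂ S' π' := by
  unfold junctionRestrict₂
  rw [sum_statePushforward_mul]
  simp_rw [rowReadout₂_restrictState₂]

/-- `J_{S,S'}` preserves the total mass (two-star states). [folklore] -/
theorem sum_junctionInsert₂ (h : S ⊆ S') (μ : RowState₂ S → ℝ) :
    ∑ π', junctionInsert₂ h μ π' = ∑ π, μ π :=
  sum_statePushforward _ μ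

/-- `J_{S',S}` preserves the total mass (two-star states). [folklore] -/
theorem sum_junctionRestrict₂ (h : S ⊆ S') (μ' : RowState₂ S' → ℝ) :
    ∑ π, junctionRestrict₂ h μ' π = ∑ π', μ' π' :=
  sum_statePushforward _ μ'

end TwoStar

end Literature.Probability.LatticeModels

end
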